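import Literature.NumberTheory.Automorphic.GL2HeckePrimitiveDoubleCosetDegree
import HarnessLib

/-!
# `deg T(p^l, p^{l+k}) = deg T(1, p^k) = p^{k-1}(p + 1)` and `deg T(p^l, p^l) = 1` for `Λ = GL_2(ℤ)`
# (Shimura Thm. 3.24 (6); Prop. 3.17)

Topic `NumberTheory/Automorphic`; namespace `Literature.NumberTheory.Automorphic.heckeAlgebra` (lane `lit-hodgefound`,
Track 2 foundations; seat `lit-hodgefound-p11`, generation 39, row g39-#13).  THEOREMS ONLY: no definition, no named
fact, no instance, no notation.

## Source, as printed

Shimura, *Introduction to the Arithmetic Theory of Automorphic Functions* (1971), §3.3 THEOREM 3.24 (`n = 2`):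
«(6) `deg(T(1, p^k)) = deg(T(p^l, p^{l+k})) = p^{k-1}(p + 1)` (`k > 0`)», and in the proof (p. 83) «`deg(T(p, p))
= 1`»; §3.2 PROPOSITION 3.17: «`T(c, c, …, c) T(b_1, …, b_n) = T(cb_1, …, cb_n)`» (for `c = p`: `ΓcαΓ = c·ΓαΓ` is
the union of the translates by `c` of the cosets of `ΓαΓ`, so the degree is unchanged).  Here `deg(ΓαΓ)` = the
number of cosets in `ΓαΓ` (Prop. 3.3); in the tree: `#(Λ g Λ / Λ)`, the cardinality of the `Λ`-orbit of `gΛ`.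

## What is formalised (theorems only)

* §1 (any Hecke pair `(G, K)`, `z` central): **`card_orbit_central_mul`** (`#(K zg K / K) = #(K g K / K)`),
  `card_orbit_of_central` (`#(K z K / K) = 1`);
* §2 (`GL_2`): `card_orbit_diagonalGL_primePow_add` (`deg T(p^l, p^{l+k}) = deg T(1, p^k)`),
  **`card_orbit_diagonalGL_primePow_of_lt`** — THM 3.24 (6): `deg T(p^a, p^b) = p^{b-a-1}(p + 1)` for `a < b`, and
  **`card_orbit_diagonalGL_primePow_self`** (`deg T(p^a, p^a) = 1`).

## References
* [ShimuraIATAF1971] G. Shimura, *Introduction to the Arithmetic Theory of Automorphic Functions*, Publ. Math. Soc.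
  Japan 11 (1971), §3.2 Prop. 3.17, §3.3 Thm. 3.24 (6) and proof (p. 83), §3.1 Prop. 3.3.
* [AndrianovZhuravlev1995] A. N. Andrianov, V. G. Zhuravlev, *Modular Forms and Hecke Operators*, Transl. Math.
  Monogr. 145, AMS (1995), Ch. 3 §2.2 Lemma 2.4.
-/

noncomputable section

open scoped MatrixGroups

open MulAction MonoidAlgebra Representation

namespace Literature.NumberTheory.Automorphic

namespace heckeAlgebra

/-! ## §1 Central translates of double cosets have the same number of cosets -/

section General

variable {G : Type*} [Group G] (K : Subgroup G) [IsHeckeTriple (⊤ : Submonoid G) K K]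

/-- The sum of the coefficients of `∑_{a ∈ B} [f a]` is `#B`. [folklore] -/
private theorem sum_coeff_sum_single' {α X : Type*} (B : Finset α) (f : α → X) :
    ((∑ a ∈ B, single (f a) (1 : ℚ)).coeff.sum fun _ c => c) = B.card := by
  classical
  rw [coeff_sum, ← Finsupp.sum_finsetSum_index (fun _ => rfl) (fun _ _ _ => rfl)]
  simp only [coeff_single, Finsupp.sum_single_index]
  rw [Finset.sum_const, nsmul_eq_mul, mul_one]

/-- **`#(K zg K / K) = #(K g K / K)` for central `z`** (`K zgK = z · KgK` is the union of the `z`-translates of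
the cosets of `KgK`: Prop. 3.17, Lemma 2.4). [cite: ShimuraIATAF1971, §3.2 Prop. 3.17]
[cite: AndrianovZhuravlev1995, Ch. 3 §2.2 Lemma 2.4] -/
theorem card_orbit_central_mul {z : G} (hz : ∀ x : G, x * z = z * x) (g : G) :
    (finite_orbit_quotient K (z * g)).toFinset.card = (finite_orbit_quotient K g).toFinset.card := by
  classical
  have h := doubleCosetIndicator_central_mul (k := ℚ) K hz g
  rw [doubleCosetIndicator_eq_sum, doubleCosetIndicator_eq_sum, map_sum] at h
  simp only [ofMulAction_single] at h
  have hsum := congr_arg (fun v : MonoidAlgebra ℚ (G ⧸ K) => v.coeff.sum fun _ c => c) h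
  simp only [sum_coeff_sum_single'] at hsum
  exact_mod_cast (by simpa [sum_coeff_sum_single'] using hsum :
    ((finite_orbit_quotient K (z * g)).toFinset.card : ℚ) = (finite_orbit_quotient K g).toFinset.card)

/-- **`#(K z K / K) = 1` for central `z`** (`K z K = zK`; «`deg(T(p, p)) = 1`»).
[cite: ShimuraIATAF1971, §3.3 Thm. 3.24 (proof, `deg(T(p, p)) = 1`)] -/
theorem card_orbit_of_central {z : G} (hz : ∀ x : G, x * z = z * x) :
    (finite_orbit_quotient K z).toFinset.card = 1 := by
  classical
  have h := card_orbit_central_mul K hz 1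
  rw [mul_one] at h
  rw [h]
  have h1 : (finite_orbit_quotient K (1 : G)).toFinset = {((1 : G) : G ⧸ K)} := by
    ext y
    rw [Set.Finite.mem_toFinset, Finset.mem_singleton]
    constructor
    · rintro ⟨κ, rfl⟩
      exact smul_coe_one K κ.2
    · rintro rfl
      exact mem_orbit_self _
  rw [h1, Finset.card_singleton]

end General

/-! ## §2 `GL_2`: `deg T(p^a, p^b)` -/

section GL2

variable {p : ℕ}

/-- **`deg T(p^l, p^{l+k}) = deg T(1, p^k)`**: multiplying by the central `pE_2` `l` times does not change the
number of cosets (Prop. 3.17). [cite: ShimuraIATAF1971, §3.3 Thm. 3.24 (6)] [cite: ShimuraIATAF1971, §3.2 Prop. 3.17] -/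
theorem card_orbit_diagonalGL_primePow_add (hp : p.Prime) (l k : ℕ) :
    (haveI := isHeckeTriple_glnInt_glnRat (Fin 2);
      (finite_orbit_quotient (Matrix.GeneralLinearGroup.map (n := Fin 2) (Int.castRingHom ℚ)).range
        (diagonalGL (Fin 2) ℚ fun i => Units.mk0 ((p : ℚ) ^ (![l, l + k] : Fin 2 → ℕ) i)
          (pow_ne_zero _ (Nat.cast_ne_zero.mpr hp.ne_zero)))).toFinset.card) =
      (haveI := isHeckeTriple_glnInt_glnRat (Fin 2);
      (finite_orbit_quotient (Matrix.GeneralLinearGroup.map (n := Fin 2) (Int.castRingHom ℚ)).range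
        (diagonalGL (Fin 2) ℚ fun i => Units.mk0 ((p : ℚ) ^ (![0, k] : Fin 2 → ℕ) i)
          (pow_ne_zero _ (Nat.cast_ne_zero.mpr hp.ne_zero)))).toFinset.card) := by
  haveI := isHeckeTriple_glnInt_glnRat (Fin 2)
  induction l with
  | zero => rw [Nat.zero_add]
  | succ l ih =>
    rw [← ih, show (![l + 1, l + 1 + k] : Fin 2 → ℕ) = fun i => (![l, l + k] : Fin 2 → ℕ) i + 1 from by
        funext i; fin_cases i
        · rfl
        · simp only [Fin.mk_one, Matrix.cons_val_one, Matrix.cons_val_fin_one]; omega,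
      ← pScalar_mul_diagonalGL_primePow hp]
    exact card_orbit_central_mul _ (pScalar_comm hp.pos) _

/-- **SHIMURA THEOREM 3.24 (6): `deg T(p^a, p^b) = p^{b-a-1}(p + 1)` for `a < b`** — the double coset
`Λ diag(p^a, p^b) Λ`, `Λ = GL_2(ℤ)`, consists of `p^{b-a-1}(p + 1)` cosets («`deg(T(1, p^k)) = deg(T(p^l, p^{l+k})) =
p^{k-1}(p + 1)` (`k > 0`)»). [cite: ShimuraIATAF1971, §3.3 Thm. 3.24 (6)] -/
theorem card_orbit_diagonalGL_primePow_of_lt (hp : p.Prime) {a b : ℕ} (hab : a < b) :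
    (haveI := isHeckeTriple_glnInt_glnRat (Fin 2);
      (finite_orbit_quotient (Matrix.GeneralLinearGroup.map (n := Fin 2) (Int.castRingHom ℚ)).range
        (diagonalGL (Fin 2) ℚ fun i => Units.mk0 ((p : ℚ) ^ (![a, b] : Fin 2 → ℕ) i)
          (pow_ne_zero _ (Nat.cast_ne_zero.mpr hp.ne_zero)))).toFinset.card) = p ^ (b - a - 1) * (p + 1) := by
  obtain ⟨k, rfl⟩ := Nat.exists_eq_add_of_lt hab
  rw [show a + k + 1 = a + (k + 1) by ring, card_orbit_diagonalGL_primePow_add hp a (k + 1),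
    card_orbit_diagonalGL_one_prime_pow hp (Nat.le_add_left 1 k), show a + (k + 1) - a - 1 = k + 1 - 1 by omega]

/-- **`deg T(p^a, p^a) = 1`** («`deg(T(p, p)) = 1`»; `Λ (p^a E_2) Λ = p^a E_2 Λ` is a single coset).
[cite: ShimuraIATAF1971, §3.3 Thm. 3.24 (proof)] [cite: ShimuraIATAF1971, §3.2 Prop. 3.17] -/
theorem card_orbit_diagonalGL_primePow_self (hp : p.Prime) (a : ℕ) :
    (haveI := isHeckeTriple_glnInt_glnRat (Fin 2);
      (finite_orbit_quotient (Matrix.GeneralLinearGroup.map (n := Fin 2) (Int.castRingHom ℚ)).range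
        (diagonalGL (Fin 2) ℚ fun i => Units.mk0 ((p : ℚ) ^ (![a, a] : Fin 2 → ℕ) i)
          (pow_ne_zero _ (Nat.cast_ne_zero.mpr hp.ne_zero)))).toFinset.card) = 1 := by
  haveI := isHeckeTriple_glnInt_glnRat (Fin 2)
  have h := card_orbit_diagonalGL_primePow_add hp a 0
  rw [Nat.add_zero] at h
  rw [h]
  -- `diag(p^0, p^0) = 1`
  have h1 : (diagonalGL (Fin 2) ℚ fun i => Units.mk0 ((p : ℚ) ^ (![0, 0] : Fin 2 → ℕ) i)
      (pow_ne_zero _ (Nat.cast_ne_zero.mpr hp.ne_zero))) = 1 := by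
    rw [← map_one (diagonalGL (Fin 2) ℚ)]
    congr 1
    funext i
    ext
    rw [Units.val_mk0, Pi.one_apply, Units.val_one]
    fin_cases i <;> simp
  rw [h1]
  exact card_orbit_of_central _ (fun x => by rw [mul_one, one_mul])

end GL2

end heckeAlgebra

end Literature.NumberTheory.Automorphic
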